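import Literature.Geometry.Kaehler.RegularZeroLocusDivision
import Literature.Geometry.Kaehler.HolomorphicLineBundleCechComap
import Literature.Algebra.Homology.NatCochainDegreeZeroComparison
import HarnessLib

/-!
# Serre's restriction sequence of twisted Čech complexes along one equation of a transverse flag

Layer `Literature/Geometry/Kaehler`. One step of the dimension count of J.-P. Serre's Théorème A
for line bundles (*FAC* (1955) n° 81; *GAGA* (1956) n° 16 Lemme 8; D. Mumford, *Abelian Varieties*
§16), on the GENUINE complex submanifolds of a transverse flag (`RegularZeroLocus`): let `Q'` be the
prefix of length `k'` of regular equations `Q` of length `k' + 1` on `M`, `Z' ⊇ Z` their zero loci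
(compact complex manifolds), `L₀ → L₁` two cocycle line bundles on `M` with a section `t` of
`Hom(L₀, L₁)` whose coordinate in the frame of each member `V_k` of a framed cover `𝔙` of `M` IS
the last equation `(F_{a(k)})_{k'}` (`RestrictionStep`; in the application `L₁ = L₀ ⊗ 𝒪(H)` and `t`
is the section of `𝒪(H)` cutting out the next hyperplane section). Pulling everything back to `Z'`
and `Z` (`HolomorphicLineBundleCechComap`) gives cochain complexes

  `A = C•(𝔙 ∩ Z', L₀|Z')`, `B = C•(𝔙 ∩ Z', L₁|Z')`, `C = C•(𝔙 ∩ Z, L₁|Z)`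

and cochain maps `mul : A → B` (multiplication by `t|Z'`) and `res : B → C` (restriction), with:

* `RestrictionStep.mul_injective` — `mul` is injective (`{t ≠ 0}` is dense in `Z'`,
  `IsPrefix.mem_closure_lastEq_ne_zero`);
* `RestrictionStep.res_mul` — `res ∘ mul = 0` (`t` vanishes on `Z`);
* `RestrictionStep.exists_mul_eq_of_res_eq_zero` — **`ker res = im mul`** (division by the last
  equation on the manifold `Z'`, `IsPrefix.exists_eq_lastEq_mul`);
* `RestrictionStep.finrank_six_term_le` — **the six-term inequality**
  `h⁰(A) + h⁰(C) + h¹(B) ≤ h⁰(B) + h¹(A) + h¹(C)` as soon as `res` is ONTO IN DEGREE `0` and the six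
  spaces are finite-dimensional (`NatCochain.ShortExactSeq.finrank_six_term_le_of_comparison` for
  `0 → A → B → B/A → 0` and the injective comparison `B/A → C`). No surjectivity of `res` in
  positive degrees is needed — this is what allows arbitrary (non-Leray, non-adapted) finite
  intersections.

Everything is proved; the definitions are `RestrictionStep` and its complexes and maps.

## References

* J.-P. Serre, *Faisceaux algébriques cohérents*, Ann. of Math. 61 (1955), n° 81. [SerreFAC1955]
* J.-P. Serre, *Géométrie algébrique et géométrie analytique*, Ann. Inst. Fourier 6 (1956), n° 16
  Lemme 8. [SerreGAGA1956]
* D. Mumford, *Abelian Varieties* (1970), §16. [MumfordAV1970]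
-/

noncomputable section

open scoped Manifold ContDiff Topology
open Set Filter Function Module Literature.Algebra.Homology

namespace Literature.Geometry.Kaehler

open HolomorphicLineBundle HolomorphicLineBundle.FramedCover

variable {E : Type*} [NormedAddCommGroup E] [NormedSpace ℂ E] [FiniteDimensional ℂ E]
  {M : Type*} [TopologicalSpace M] [ChartedSpace E M] [IsManifold 𝓘(ℂ, E) ω M]
  {α : Type*} {k' d d' : ℕ} {ι κ : Type*}

/-! ### The data of one restriction step -/

/-- **One step of Serre's restriction along a transverse flag.** Regular equations `Q` of length
`k' + 1` with their prefix `Q'` of length `k'`; two cocycle line bundles `L₀, L₁` on `M` on the same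
indexing of frames and a section `t` of `Hom(L₀, L₁)`; a framed cover of `M` for `L₀` whose members
are small for `L₁` and for the charts of the equations (`chartIdx`), such that **the coordinate of
`t` in the frame of `V_k` is the last equation in the chart of `V_k`**. In the application
`L₁ = L₀ ⊗ 𝒪_X(H)^an`, `t` = an algebraic section of `𝒪_X(H)` (`homSectionOfIsSection`) whose
coordinates are the flag functions of `exists_transverse_flag`. [cite: SerreGAGA1956, n° 16 Lemme 8] -/
structure RestrictionStep (Q' : RegularEquations E M α k') (Q : RegularEquations E M α (k' + 1))
    (ι κ : Type*) where
  /-- `Q'` is the prefix of `Q` -/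
  isPrefix : Q'.IsPrefix Q (Nat.le_succ k')
  /-- the source bundle (`L(m)`) -/
  L₀ : HolomorphicLineBundle ι E M
  /-- the target bundle (`L(m+1)`) -/
  L₁ : HolomorphicLineBundle ι E M
  /-- the section of `Hom(L₀, L₁)` (multiplication by the next hyperplane equation) -/
  t : HomSection L₀ L₁
  /-- the framed cover of `M` -/
  cover : L₀.FramedCover κ
  /-- its members are small for `L₁` -/
  subset_L₁ : ∀ k, cover.U k ⊆ L₁.baseSet (cover.frame k)
  /-- the chart of the equations attached to a member -/
  chartIdx : κ → α
  /-- its members are small for the charts of the equations -/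
  subset_O : ∀ k, cover.U k ⊆ Q.O (chartIdx k)
  /-- the coordinate of `t` in the frame of `V_k` is the last equation in the chart of `V_k` -/
  coord_eq : ∀ k, ∀ x ∈ cover.U k, t.coord (cover.frame k) x = Q.F (chartIdx k) x (Fin.last k')

namespace RestrictionStep

variable {Q' : RegularEquations E M α k'} {Q : RegularEquations E M α (k' + 1)}
  (S : RestrictionStep Q' Q ι κ) (hd : finrank ℂ E = (k' + 1) + d) (hd' : finrank ℂ E = k' + d')

/-! ### The three complexes -/

/-- The cover `𝔙 ∩ Z'` of the bigger locus for `L₀|Z'` (complex `A`). [cite: SerreGAGA1956, n° 16 Lemme 8] -/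
def coverA : (S.L₀.pullback (Q'.atlas hd').val (Q'.atlas hd').mdifferentiable_val).FramedCover κ :=
  S.cover.comap (Q'.atlas hd').val (Q'.atlas hd').mdifferentiable_val

/-- The members of `𝔙 ∩ Z'` are small for `L₁|Z'`. [folklore] -/
theorem coverA_subset_L₁ (k : κ) :
    (S.coverA hd').U k ⊆ (S.L₁.pullback (Q'.atlas hd').val (Q'.atlas hd').mdifferentiable_val).baseSet
      ((S.coverA hd').frame k) :=
  preimage_mono (S.subset_L₁ k)

/-- The cover `𝔙 ∩ Z'` of the bigger locus for `L₁|Z'` (complex `B`). [cite: SerreGAGA1956, n° 16 Lemme 8] -/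
def coverB : (S.L₁.pullback (Q'.atlas hd').val (Q'.atlas hd').mdifferentiable_val).FramedCover κ :=
  (S.coverA hd').transfer _ (S.coverA_subset_L₁ hd')

/-- The cover `𝔙 ∩ Z` of the smaller locus for `L₁|Z` (complex `C`). [cite: SerreGAGA1956, n° 16 Lemme 8] -/
def coverC : (S.L₁.pullback (Q.atlas hd).val (Q.atlas hd).mdifferentiable_val).FramedCover κ :=
  (S.cover.transfer S.L₁ S.subset_L₁).comap (Q.atlas hd).val (Q.atlas hd).mdifferentiable_val

/-- The members of the three covers (definitional). [folklore] -/
@[simp] theorem coverA_U (k : κ) : (S.coverA hd').U k = (Q'.atlas hd').val ⁻¹' S.cover.U k := rfl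

/-- The members of `B` (definitional). [folklore] -/
@[simp] theorem coverB_U (k : κ) : (S.coverB hd').U k = (Q'.atlas hd').val ⁻¹' S.cover.U k := rfl

/-- The members of `C` (definitional). [folklore] -/
@[simp] theorem coverC_U (k : κ) : (S.coverC hd).U k = (Q.atlas hd).val ⁻¹' S.cover.U k := rfl

/-- The frames (definitional). [folklore] -/
@[simp] theorem coverA_frame (k : κ) : (S.coverA hd').frame k = S.cover.frame k := rfl

/-- The frames of `B` (definitional). [folklore] -/
@[simp] theorem coverB_frame (k : κ) : (S.coverB hd').frame k = S.cover.frame k := rfl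

/-- The frames of `C` (definitional). [folklore] -/
@[simp] theorem coverC_frame (k : κ) : (S.coverC hd).frame k = S.cover.frame k := rfl

/-- The covers of `Z'` and `Z` cover them when `𝔙` covers `M`. [folklore] -/
theorem coverA_covers (hcov : ∀ x : M, ∃ k, x ∈ S.cover.U k) (y : (Q'.atlas hd').Carrier) :
    ∃ k, y ∈ (S.coverA hd').U k :=
  hcov _

/-- `𝔙 ∩ Z` covers `Z` when `𝔙` covers `M`. [folklore] -/
theorem coverC_covers (hcov : ∀ x : M, ∃ k, x ∈ S.cover.U k) (y : (Q.atlas hd).Carrier) :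
    ∃ k, y ∈ (S.coverC hd).U k :=
  hcov _

/-- **`C` is the pull-back of `B` along the inclusion `Z → Z'`.** [folklore] -/
theorem isComap_BC : IsComap (S.coverB hd') (S.coverC hd) (S.isPrefix.incl hd hd') :=
  ⟨fun _ ↦ rfl, fun _ ↦ rfl, fun _ _ _ ↦ rfl⟩

/-! ### The two cochain maps -/

/-- The last equation of a member, read on `Z'`: on `V_k ∩ Z'` the coordinate of `t|Z'` in the frame
of `V_k`. [folklore] -/
theorem coord_pullback_eq {k : κ} {y : (Q'.atlas hd').Carrier} (hy : y ∈ (S.coverA hd').U k) :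
    (S.t.pullback (Q'.atlas hd').val (Q'.atlas hd').mdifferentiable_val).coord (S.cover.frame k) y =
      S.isPrefix.lastEq hd' (S.chartIdx k) y :=
  S.coord_eq k _ hy

/-- **`mul : A → B`, multiplication by `t|Z'`.** [cite: SerreGAGA1956, n° 16 Lemme 8] -/
def mul (a : ℕ) : (S.coverA hd').Cochain a →ₗ[ℂ] (S.coverB hd').Cochain a :=
  (S.coverA hd').mulCochain (S.t.pullback _ (Q'.atlas hd').mdifferentiable_val) (S.coverA_subset_L₁ hd') a

/-- `mul` commutes with the differentials. [cite: SerreFAC1955, n° 81] -/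
theorem delta_mul (a : ℕ) (c : (S.coverA hd').Cochain a) :
    (S.coverB hd').delta a (S.mul hd' a c) = S.mul hd' (a + 1) ((S.coverA hd').delta a c) :=
  (S.coverA hd').delta_mulCochain _ _ a c

/-- `mul` at a point of `V_J ∩ Z'`: multiplication by the last equation. [folklore] -/
theorem mul_apply_apply_of_mem {a : ℕ} (c : (S.coverA hd').Cochain a) {J : Fin (a + 1) → κ}
    {y : (Q'.atlas hd').Carrier} (hy : y ∈ cechSet (S.coverA hd').U J) :
    (S.mul hd' a c J : (Q'.atlas hd').Carrier → ℂ) y =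
      S.isPrefix.lastEq hd' (S.chartIdx (J 0)) y * (c J : (Q'.atlas hd').Carrier → ℂ) y := by
  have h1 := (S.coverA hd').mulCochain_apply_apply_of_mem
    (S.t.pullback (Q'.atlas hd').val (Q'.atlas hd').mdifferentiable_val) (S.coverA_subset_L₁ hd') c hy
  rw [coverA_frame, S.coord_pullback_eq hd' (cechSet_subset_apply _ J 0 hy)] at h1
  exact h1

/-- `mul` off `V_J ∩ Z'`. [folklore] -/
theorem mul_apply_apply_of_notMem {a : ℕ} (c : (S.coverA hd').Cochain a) {J : Fin (a + 1) → κ}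
    {y : (Q'.atlas hd').Carrier} (hy : y ∉ cechSet (S.coverA hd').U J) :
    (S.mul hd' a c J : (Q'.atlas hd').Carrier → ℂ) y = 0 :=
  (S.coverA hd').mulCochain_apply_apply_of_notMem _ _ c hy

include hd in
/-- **`mul` is injective**: `{t ≠ 0} ∩ V_J` is dense in `V_J ∩ Z'` (the last equation is a coordinate
of `Z'` near its zeros). [cite: SerreGAGA1956, n° 16 (proof of Lemme 8)] -/
theorem mul_injective (a : ℕ) : Injective (S.mul hd' a) := by
  refine (S.coverA hd').mulCochain_injective _ _ fun J y hy ↦ ?_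
  have hyk : y ∈ (S.coverA hd').U (J 0) := cechSet_subset_apply _ J 0 hy
  have hya : (Q'.atlas hd').val y ∈ Q.O (S.chartIdx (J 0)) := S.subset_O _ hyk
  have hcl := S.isPrefix.mem_closure_lastEq_ne_zero hd hd' (S.chartIdx (J 0)) hya
  have hopen : IsOpen ((S.coverA hd').U (J 0)) := (S.coverA hd').isOpen (J 0)
  have h1 : y ∈ closure ((S.coverA hd').U (J 0) ∩ {y' | S.isPrefix.lastEq hd' (S.chartIdx (J 0)) y' ≠ 0}) :=
    hopen.inter_closure ⟨hyk, hcl⟩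
  refine closure_mono ?_ h1
  rintro y' ⟨hy'k, hy'⟩
  change (S.t.pullback (Q'.atlas hd').val (Q'.atlas hd').mdifferentiable_val).coord
    ((S.coverA hd').frame (J 0)) y' ≠ 0
  rwa [coverA_frame, S.coord_pullback_eq hd' hy'k]

/-- **`res : B → C`, restriction to `Z`.** [cite: SerreGAGA1956, n° 16 Lemme 8] -/
def res (a : ℕ) : (S.coverB hd').Cochain a →ₗ[ℂ] (S.coverC hd).Cochain a :=
  (S.isComap_BC hd hd').cochainMap (S.isPrefix.mdifferentiable_incl hd hd') a

/-- `res` commutes with the differentials. [cite: SerreFAC1955, n° 81] -/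
theorem delta_res (a : ℕ) (b : (S.coverB hd').Cochain a) :
    (S.coverC hd).delta a (S.res hd hd' a b) = S.res hd hd' (a + 1) ((S.coverB hd').delta a b) :=
  (S.isComap_BC hd hd').delta_cochainMap _ a b

/-- `res` pointwise (definitional): evaluate at the point of `Z'` under a point of `Z`. [folklore] -/
@[simp]
theorem res_apply_apply {a : ℕ} (b : (S.coverB hd').Cochain a) (J : Fin (a + 1) → κ) (x : (Q.atlas hd).Carrier) :
    (S.res hd hd' a b J : (Q.atlas hd).Carrier → ℂ) x =
      (b J : (Q'.atlas hd').Carrier → ℂ) (S.isPrefix.incl hd hd' x) :=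
  rfl

/-- Under a point of `Z` over `O_a` the last equation vanishes. [folklore] -/
theorem lastEq_incl {k : κ} {x : (Q.atlas hd).Carrier} (hx : x ∈ (S.coverC hd).U k) :
    S.isPrefix.lastEq hd' (S.chartIdx k) (S.isPrefix.incl hd hd' x) = 0 := by
  have hxa : (Q'.atlas hd').val (S.isPrefix.incl hd hd' x) ∈ Q.O (S.chartIdx k) := S.subset_O k hx
  rw [S.isPrefix.lastEq_eq_zero_iff hd' (S.chartIdx k) hxa]
  exact (Q.atlas hd).val_mem x

/-- **`res ∘ mul = 0`**: `t` vanishes on `Z`. [cite: SerreGAGA1956, n° 16 Lemme 8] -/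
theorem res_mul (a : ℕ) (c : (S.coverA hd').Cochain a) : S.res hd hd' a (S.mul hd' a c) = 0 := by
  funext J
  refine Subtype.ext (funext fun x ↦ ?_)
  rw [res_apply_apply]
  change _ = (0 : (Q.atlas hd).Carrier → ℂ) x
  rw [Pi.zero_apply]
  by_cases hx : S.isPrefix.incl hd hd' x ∈ cechSet (S.coverA hd').U J
  · rw [S.mul_apply_apply_of_mem hd' c hx]
    have hxC : x ∈ cechSet (S.coverC hd).U J := (S.isComap_BC hd hd').mem_cechSet_iff'.2 hx
    have hxk : x ∈ (S.coverC hd).U (J 0) := cechSet_subset_apply _ J 0 hxC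
    rw [S.lastEq_incl hd hd' hxk, zero_mul]
  · exact S.mul_apply_apply_of_notMem hd' c hx

include hd in
/-- **`ker res ⊆ im mul`** (division by the last equation on the manifold `Z'`, member by member of
the nerve: a section over `V_J ∩ Z'` vanishing on `V_J ∩ Z` is the last equation times a section).
[cite: SerreGAGA1956, n° 16 Lemme 8] [cite: Chirka1989, §2.8] -/
theorem exists_mul_eq_of_res_eq_zero {a : ℕ} {b : (S.coverB hd').Cochain a} (hb : S.res hd hd' a b = 0) :
    ∃ c : (S.coverA hd').Cochain a, S.mul hd' a c = b := by
  classical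
  -- division on each `V_J ∩ Z'`
  have key : ∀ J : Fin (a + 1) → κ, ∃ q : (Q'.atlas hd').Carrier → ℂ,
      MDifferentiableOn 𝓘(ℂ, Fin d' → ℂ) 𝓘(ℂ, ℂ) q (cechSet (S.coverA hd').U J) ∧
        ∀ y ∈ cechSet (S.coverA hd').U J, (b J : (Q'.atlas hd').Carrier → ℂ) y =
          S.isPrefix.lastEq hd' (S.chartIdx (J 0)) y * q y := by
    intro J
    refine S.isPrefix.exists_eq_lastEq_mul hd hd' (S.chartIdx (J 0)) (isOpen_cechSet (S.coverA hd').isOpen J)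
      (fun y hy ↦ S.subset_O (J 0) (show y ∈ (S.coverA hd').U (J 0) from cechSet_subset_apply _ J 0 hy))
      (holFunOn.mdifferentiableOn (b J)) fun y hy hyZ ↦ ?_
    -- `y = incl x` for the point `x` of `Z` under it
    set x : (Q.atlas hd).Carrier := (Q.atlas hd).ofSubtype ⟨(Q'.atlas hd').val y, hyZ⟩ with hxdef
    have hxy : S.isPrefix.incl hd hd' x = y := (Q'.atlas hd').val_injective rfl
    have h0 := congr_fun (congr_arg Subtype.val (congr_fun hb J)) x
    rw [res_apply_apply, hxy] at h0
    exact h0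
  choose q hq hbq using key
  refine ⟨fun J ↦ ⟨(cechSet (S.coverA hd').U J).indicator (q J),
    (hq J).congr (fun y hy ↦ indicator_of_mem hy _), fun y hy ↦ indicator_of_notMem hy _⟩, ?_⟩
  funext J
  refine Subtype.ext (funext fun y ↦ ?_)
  by_cases hy : y ∈ cechSet (S.coverA hd').U J
  · rw [S.mul_apply_apply_of_mem hd' _ hy, hbq J y hy]
    change _ * (cechSet (S.coverA hd').U J).indicator (q J) y = _
    rw [indicator_of_mem hy]
  · rw [S.mul_apply_apply_of_notMem hd' _ hy]
    exact (holFunOn.apply_of_notMem (b J) hy).symm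

include hd in
/-- **Exactness in the middle**: `im mul = ker res`. [cite: SerreGAGA1956, n° 16 Lemme 8] -/
theorem exact_mul_res (a : ℕ) : Function.Exact (S.mul hd' a) (S.res hd hd' a) := by
  intro b
  refine ⟨fun hb ↦ ?_, ?_⟩
  · obtain ⟨c, rfl⟩ := S.exists_mul_eq_of_res_eq_zero hd hd' hb
    exact ⟨c, rfl⟩
  · rintro ⟨c, rfl⟩
    exact S.res_mul hd hd' a c

/-! ### The short exact sequence and the six-term inequality -/

/-- **The short exact sequence `0 → A → B → B/A → 0`** of the injective cochain map `mul`. [cite: Weibel1994, Thm. 1.3.1] -/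
def shortExactSeq : NatCochain.ShortExactSeq (fun a ↦ (S.coverA hd').delta a) (fun a ↦ (S.coverB hd').delta a)
    (NatCochain.cokerD (S.mul hd') (fun a c ↦ (S.delta_mul hd' a c).symm)) :=
  NatCochain.cokerSeq (S.mul hd') (fun a c ↦ (S.delta_mul hd' a c).symm) (S.mul_injective hd hd')
    fun a c ↦ (S.coverB hd').delta_delta a c

/-- `im mul ≤ ker res` degreewise. [folklore] -/
theorem range_mul_le_ker_res (a : ℕ) : LinearMap.range (S.mul hd' a) ≤ LinearMap.ker (S.res hd hd' a) := by
  rintro _ ⟨c, rfl⟩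
  exact S.res_mul hd hd' a c

/-- **The comparison `B/A → C` induced by `res`.** [folklore] -/
def comparison (a : ℕ) : NatCochain.Coker (S.mul hd') a →ₗ[ℂ] (S.coverC hd).Cochain a :=
  (LinearMap.range (S.mul hd' a)).liftQ (S.res hd hd' a) (S.range_mul_le_ker_res hd hd' a)

/-- The comparison on classes (definitional). [folklore] -/
@[simp]
theorem comparison_mk (a : ℕ) (b : (S.coverB hd').Cochain a) :
    S.comparison hd hd' a (Submodule.Quotient.mk b) = S.res hd hd' a b :=
  rfl

/-- The comparison is a cochain map. [folklore] -/
theorem comparison_comm (a : ℕ) (x : NatCochain.Coker (S.mul hd') a) :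
    S.comparison hd hd' (a + 1) (NatCochain.cokerD (S.mul hd') (fun a c ↦ (S.delta_mul hd' a c).symm) a x) =
      (S.coverC hd).delta a (S.comparison hd hd' a x) := by
  obtain ⟨b, rfl⟩ := Submodule.Quotient.mk_surjective _ x
  rw [NatCochain.cokerD_mk, comparison_mk, comparison_mk, delta_res]

/-- **The comparison is injective** (`ker res = im mul`). [folklore] -/
theorem comparison_injective (a : ℕ) : Injective (S.comparison hd hd' a) := by
  rw [← LinearMap.ker_eq_bot, comparison]
  exact Submodule.ker_liftQ_eq_bot _ _ _ fun b hb ↦ ((S.exact_mul_res hd hd' a) b).1 hb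

/-- The comparison is onto in degree `0` when `res` is. [folklore] -/
theorem comparison_surjective_zero (h0 : Surjective (S.res hd hd' 0)) : Surjective (S.comparison hd hd' 0) := by
  intro c
  obtain ⟨b, rfl⟩ := h0 c
  exact ⟨Submodule.Quotient.mk b, rfl⟩

/-- **The six-term inequality of the restriction step** (Serre's
`χ(L₁|Z') ≥ χ(L₀|Z') + χ(L₁|Z)` truncated at `H¹`): if `res` is onto in degree `0` and the six
cohomology spaces are finite-dimensional then
`h⁰(A) + h⁰(C) + h¹(B) ≤ h⁰(B) + h¹(A) + h¹(C)`. [cite: SerreGAGA1956, n° 16 Lemme 8 (dimension count)] -/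
theorem finrank_six_term_le (h0 : Surjective (S.res hd hd' 0))
    [FiniteDimensional ℂ ((S.coverA hd').cohomology 1)] [FiniteDimensional ℂ ((S.coverB hd').cohomology 0)]
    [FiniteDimensional ℂ ((S.coverB hd').cohomology 1)] [FiniteDimensional ℂ ((S.coverC hd).cohomology 0)]
    [FiniteDimensional ℂ ((S.coverC hd).cohomology 1)] :
    finrank ℂ ((S.coverA hd').cohomology 0) + finrank ℂ ((S.coverC hd).cohomology 0) +
        finrank ℂ ((S.coverB hd').cohomology 1) ≤
      finrank ℂ ((S.coverB hd').cohomology 0) + finrank ℂ ((S.coverA hd').cohomology 1) +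
        finrank ℂ ((S.coverC hd).cohomology 1) := by
  haveI : FiniteDimensional ℂ (NatCochain.Cohomology (R := ℂ) (fun a ↦ (S.coverA hd').delta a) 1) :=
    ‹FiniteDimensional ℂ ((S.coverA hd').cohomology 1)›
  haveI : FiniteDimensional ℂ (NatCochain.Cohomology (R := ℂ) (fun a ↦ (S.coverB hd').delta a) 0) :=
    ‹FiniteDimensional ℂ ((S.coverB hd').cohomology 0)›
  haveI : FiniteDimensional ℂ (NatCochain.Cohomology (R := ℂ) (fun a ↦ (S.coverB hd').delta a) 1) :=
    ‹FiniteDimensional ℂ ((S.coverB hd').cohomology 1)›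
  haveI : FiniteDimensional ℂ (NatCochain.Cohomology (R := ℂ) (fun a ↦ (S.coverC hd).delta a) 0) :=
    ‹FiniteDimensional ℂ ((S.coverC hd).cohomology 0)›
  haveI : FiniteDimensional ℂ (NatCochain.Cohomology (R := ℂ) (fun a ↦ (S.coverC hd).delta a) 1) :=
    ‹FiniteDimensional ℂ ((S.coverC hd).cohomology 1)›
  exact (S.shortExactSeq hd hd').finrank_six_term_le_of_comparison (S.comparison hd hd') (S.comparison_comm hd hd')
    (S.comparison_injective hd hd' 0) (S.comparison_surjective_zero hd hd' h0) (S.comparison_injective hd hd' 1)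

end RestrictionStep

end Literature.Geometry.Kaehler
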